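import Summits.RiemannHypothesis.RiemannHypothesis.Theorems.PfPersistenceEdgeLawCutKernel

/-!
# Edge law by cutting — the two one-dimensional profiles of the far singular zone (RH-free)

Part of the pub-rhpf THEORY-2 programme (mechanism / rigidity of the Weil window bottom; no RH
claims). In the far singular zone of the steep-cut commutator (one end of the jump at depth `< H`,
the other at one-sided depth `s ∈ [R, r₀]`, `2H ≤ R`), Young's inequality with weight
`√(L_H/L_s)` (`L_s = log(1/s)`) produces two correlation kernels whose `t`-profiles are bounded
here (`θ := R/(R − H)`):
* `cut_profile_far`: `∫_{t>0} 1_{[R,r₀]}(d+t) · M/(4t√L_{d+t}) dt ≤ M θ (√L_R − √L_{r₀})/2` for a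
  shallow end at depth `d ∈ [0, H]` (substitute `s = d + t`, `1/t ≤ θ/s`, and
  `∫_R^{r₀} ds/(s√L_s) = 2(√L_R − √L_{r₀})`);
* `cut_profile_shallow`: `∫_{t>0} 1_{(s−H,s)}(t)/(4tN) dt ≤ θ H/(4 s N)` for a deep end at depth
  `s ≥ R` (`1/t ≤ 1/(s−H) ≤ θ/s`),
together with the use-site forms at the right edge (`depth = a − y`) and the left edge
(`depth = a + y`). All integrals are Lebesgue integrals in `ℝ≥0∞`.

Sources: folklore calculus; the role of these profiles is explained in
`PfPersistenceEdgeLawCutMajorant` / `PfPersistenceEdgeLawCutArch` (E. Bombieri, *Remarks on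
Weil's quadratic functional in the theory of prime numbers I*, Rend. Mat. Acc. Lincei (9) 11
(2000) §4, for the archimedean form).
-/

set_option linter.dupNamespace false

noncomputable section

open MeasureTheory Set Filter
open scoped Topology ENNReal NNReal

namespace Summit.RiemannHypothesis.RiemannHypothesis.Theorems.PfPersistence

open Summit.RiemannHypothesis.RiemannHypothesis.Theorems.WeilWindowFlowWindowLipschitz

/-! ## The far profile -/

/-- `s ↦ 1/(s √(log 1/s))` is continuous on `[R, r₀] ⊂ (0, 1)`. [folklore] -/
theorem continuousOn_inv_mul_sqrt_log {R r₀ : ℝ} (hR : 0 < R) (hr1 : r₀ < 1) :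
    ContinuousOn (fun s : ℝ ↦ 1 / (s * Real.sqrt (Real.log (1 / s)))) (Icc R r₀) := by
  have hIcc : ∀ s ∈ Icc R r₀, 0 < s ∧ s < 1 := fun s hs ↦ ⟨hR.trans_le hs.1, hs.2.trans_lt hr1⟩
  refine ContinuousOn.div continuousOn_const (continuousOn_id.mul
    ((continuousOn_const.div continuousOn_id fun s hs ↦ (hIcc s hs).1.ne').log
      (fun s hs ↦ (one_div_pos.2 (hIcc s hs).1).ne')).sqrt) fun s hs ↦ ?_
  obtain ⟨hs0, hs1⟩ := hIcc s hs
  exact (mul_pos hs0 (Real.sqrt_pos.2 (stub_surplusReduction_log_pos hs0 hs1))).ne'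

/-- **Far profile.** For `0 ≤ d ≤ H < R ≤ r₀ < 1`, `M ≥ 0` and `θ = R/(R−H)`:
`∫⁻_{t>0} 1_{[R,r₀]}(d+t) M/(4t√L_{d+t}) ≤ M θ (√L_R − √L_{r₀})/2`. [folklore] -/
theorem cut_profile_far {d H R r₀ M : ℝ} (hM : 0 ≤ M) (hd0 : 0 ≤ d) (hdH : d ≤ H) (hHR : H < R)
    (hRr : R ≤ r₀) (hr1 : r₀ < 1) :
    ∫⁻ t in Ioi (0 : ℝ), ENNReal.ofReal ((Icc R r₀).indicator
        (fun s ↦ M / (4 * t * Real.sqrt (Real.log (1 / s)))) (d + t)) ≤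
      ENNReal.ofReal (M * (R / (R - H)) *
        (Real.sqrt (Real.log (1 / R)) - Real.sqrt (Real.log (1 / r₀))) / 2) := by
  have hR : 0 < R := by linarith
  set θ : ℝ := R / (R - H) with hθ
  have hθ0 : 0 ≤ θ := div_nonneg hR.le (by linarith)
  -- the comparison function of the depth `s = d + t`
  set g : ℝ → ℝ := fun s ↦ M * θ / 4 * (1 / (s * Real.sqrt (Real.log (1 / s)))) with hg
  set G : ℝ → ℝ≥0∞ := fun s ↦ (Icc R r₀).indicator (fun s ↦ ENNReal.ofReal (g s)) s with hG
  have hg0 : ∀ s ∈ Icc R r₀, 0 ≤ g s := fun s hs ↦ by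
    have hs0 : 0 < s := hR.trans_le hs.1
    have := stub_surplusReduction_log_pos hs0 (hs.2.trans_lt hr1)
    positivity
  -- pointwise comparison
  have hpt : ∀ t, ENNReal.ofReal ((Icc R r₀).indicator
      (fun s ↦ M / (4 * t * Real.sqrt (Real.log (1 / s)))) (d + t)) ≤ G (d + t) := by
    intro t
    by_cases hs : d + t ∈ Icc R r₀
    · rw [indicator_of_mem hs, hG]
      simp only [indicator_of_mem hs]
      refine ENNReal.ofReal_le_ofReal ?_
      have hs0 : 0 < d + t := hR.trans_le hs.1
      have hL : 0 < Real.log (1 / (d + t)) := stub_surplusReduction_log_pos hs0 (hs.2.trans_lt hr1)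
      have ht : 0 < t := by linarith [hs.1]
      have hinv : 1 / t ≤ θ / (d + t) := by
        have := inv_sub_le_ratio_div hd0 hdH hHR hs.1
        rwa [add_sub_cancel_left] at this
      have hsq : 0 < Real.sqrt (Real.log (1 / (d + t))) := Real.sqrt_pos.2 hL
      calc M / (4 * t * Real.sqrt (Real.log (1 / (d + t))))
          = M / 4 * (1 / Real.sqrt (Real.log (1 / (d + t)))) * (1 / t) := by
            field_simp
        _ ≤ M / 4 * (1 / Real.sqrt (Real.log (1 / (d + t)))) * (θ / (d + t)) :=
            mul_le_mul_of_nonneg_left hinv (by positivity)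
        _ = g (d + t) := by rw [hg]; field_simp
    · rw [indicator_of_notMem hs, hG]
      simp [indicator_of_notMem hs]
  -- integrate
  have hgi : IntegrableOn g (Icc R r₀) :=
    ((continuousOn_inv_mul_sqrt_log hR hr1).const_smul (M * θ / 4) |>.congr
      (fun s _ ↦ by simp [hg, smul_eq_mul])).integrableOn_Icc
  calc ∫⁻ t in Ioi (0 : ℝ), ENNReal.ofReal ((Icc R r₀).indicator
        (fun s ↦ M / (4 * t * Real.sqrt (Real.log (1 / s)))) (d + t))
      ≤ ∫⁻ t in Ioi (0 : ℝ), G (d + t) := lintegral_mono hpt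
    _ ≤ ∫⁻ t, G (d + t) := setLIntegral_le_lintegral _ _
    _ = ∫⁻ s, G s := lintegral_add_left_eq_self G d
    _ = ∫⁻ s in Icc R r₀, ENNReal.ofReal (g s) := by rw [hG, lintegral_indicator measurableSet_Icc]
    _ = ENNReal.ofReal (∫ s in Icc R r₀, g s) :=
        (ofReal_integral_eq_lintegral_ofReal hgi
          ((ae_restrict_iff' measurableSet_Icc).2 (Eventually.of_forall hg0))).symm
    _ = ENNReal.ofReal (M * θ * (Real.sqrt (Real.log (1 / R)) - Real.sqrt (Real.log (1 / r₀))) / 2) := by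
        rw [integral_Icc_eq_integral_Ioc, ← intervalIntegral.integral_of_le hRr, hg,
          intervalIntegral.integral_const_mul, integral_inv_mul_sqrt_log hR hRr hr1]
        congr 1
        ring

/-- Far profile at the RIGHT edge: the kernel `B₁(t,y) = 1_{[R,r₀]}(a−y) M/(4t√L_{a−y})`
evaluated at `y = p − t` for a shallow right end `p` (`0 ≤ a − p ≤ H`). [folklore] -/
theorem cut_profile_far_right {a p H R r₀ M : ℝ} (hM : 0 ≤ M) (hd0 : 0 ≤ a - p) (hdH : a - p ≤ H)
    (hHR : H < R) (hRr : R ≤ r₀) (hr1 : r₀ < 1) :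
    ∫⁻ t in Ioi (0 : ℝ), ENNReal.ofReal ((Icc R r₀).indicator
        (fun s ↦ M / (4 * t * Real.sqrt (Real.log (1 / s)))) (a - (p - t))) ≤
      ENNReal.ofReal (M * (R / (R - H)) *
        (Real.sqrt (Real.log (1 / R)) - Real.sqrt (Real.log (1 / r₀))) / 2) := by
  simp_rw [show ∀ t : ℝ, a - (p - t) = (a - p) + t from fun t ↦ by ring]
  exact cut_profile_far hM hd0 hdH hHR hRr hr1

/-- Far profile at the LEFT edge: the kernel `B₃(t,y) = 1_{[R,r₀]}(a+y) M/(4t√L_{a+y})`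
evaluated at `y = x + t` for a shallow left end `x` (`0 ≤ a + x ≤ H`). [folklore] -/
theorem cut_profile_far_left {a x H R r₀ M : ℝ} (hM : 0 ≤ M) (hd0 : 0 ≤ a + x) (hdH : a + x ≤ H)
    (hHR : H < R) (hRr : R ≤ r₀) (hr1 : r₀ < 1) :
    ∫⁻ t in Ioi (0 : ℝ), ENNReal.ofReal ((Icc R r₀).indicator
        (fun s ↦ M / (4 * t * Real.sqrt (Real.log (1 / s)))) (a + (x + t))) ≤
      ENNReal.ofReal (M * (R / (R - H)) *
        (Real.sqrt (Real.log (1 / R)) - Real.sqrt (Real.log (1 / r₀))) / 2) := by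
  simp_rw [show ∀ t : ℝ, a + (x + t) = (a + x) + t from fun t ↦ by ring]
  exact cut_profile_far hM hd0 hdH hHR hRr hr1

/-! ## The shallow profile -/

/-- **Shallow profile.** For `0 ≤ H < R ≤ s`, `N > 0`, `θ = R/(R−H)`:
`∫⁻_{t>0} 1_{(s−H,s)}(t)/(4tN) ≤ θ H/(4 s N)`. [folklore] -/
theorem cut_profile_shallow {s H R N : ℝ} (hH0 : 0 ≤ H) (hHR : H < R) (hRs : R ≤ s) (hN : 0 < N) :
    ∫⁻ t in Ioi (0 : ℝ), ENNReal.ofReal ((Ioo (s - H) s).indicator 1 t / (4 * t * N)) ≤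
      ENNReal.ofReal (R / (R - H) * H / (4 * s * N)) := by
  have hsH : 0 < s - H := by linarith
  have hs : 0 < s := by linarith
  have hF : ∀ t, ENNReal.ofReal ((Ioo (s - H) s).indicator 1 t / (4 * t * N)) =
      (Ioo (s - H) s).indicator (fun t ↦ ENNReal.ofReal (1 / (4 * t * N))) t := by
    intro t
    by_cases ht : t ∈ Ioo (s - H) s
    · simp [indicator_of_mem ht]
    · simp [indicator_of_notMem ht]
  have hθ := inv_sub_le_ratio_div hH0 le_rfl hHR hRs
  calc ∫⁻ t in Ioi (0 : ℝ), ENNReal.ofReal ((Ioo (s - H) s).indicator 1 t / (4 * t * N))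
      ≤ ∫⁻ t, ENNReal.ofReal ((Ioo (s - H) s).indicator 1 t / (4 * t * N)) :=
        setLIntegral_le_lintegral _ _
    _ = ∫⁻ t in Ioo (s - H) s, ENNReal.ofReal (1 / (4 * t * N)) := by
        simp_rw [hF]
        rw [lintegral_indicator measurableSet_Ioo]
    _ ≤ ∫⁻ t in Ioo (s - H) s, ENNReal.ofReal (1 / (4 * (s - H) * N)) := by
        refine setLIntegral_mono measurable_const fun t ht ↦ ENNReal.ofReal_le_ofReal ?_
        have ht0 : 0 < t := hsH.trans ht.1
        exact one_div_le_one_div_of_le (by positivity) (by nlinarith [ht.1, hN])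
    _ = ENNReal.ofReal (1 / (4 * (s - H) * N) * H) := by
        rw [setLIntegral_const, Real.volume_Ioo, ← ENNReal.ofReal_mul (by positivity),
          show s - (s - H) = H by ring]
    _ ≤ ENNReal.ofReal (R / (R - H) * H / (4 * s * N)) := by
        refine ENNReal.ofReal_le_ofReal ?_
        calc 1 / (4 * (s - H) * N) * H = H / (4 * N) * (1 / (s - H)) := by
              field_simp
          _ ≤ H / (4 * N) * (R / (R - H) / s) := mul_le_mul_of_nonneg_left hθ (by positivity)
          _ = R / (R - H) * H / (4 * s * N) := by
              field_simp

/-- Shallow profile at the RIGHT edge: the kernel `B₂(t,y) = 1_{(a−H,a)}(y)/(4tN)` evaluated at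
`y = x + t` for a deep right end `x` (`a − x ≥ R`). [folklore] -/
theorem cut_profile_shallow_right {a x H R N : ℝ} (hH0 : 0 ≤ H) (hHR : H < R) (hRs : R ≤ a - x)
    (hN : 0 < N) :
    ∫⁻ t in Ioi (0 : ℝ), ENNReal.ofReal ((Ioo (a - H) a).indicator 1 (x + t) / (4 * t * N)) ≤
      ENNReal.ofReal (R / (R - H) * H / (4 * (a - x) * N)) := by
  have hind : ∀ t : ℝ, (Ioo (a - H) a).indicator (1 : ℝ → ℝ) (x + t) =
      (Ioo (a - x - H) (a - x)).indicator 1 t := by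
    intro t
    by_cases ht : t ∈ Ioo (a - x - H) (a - x)
    · rw [indicator_of_mem ht, indicator_of_mem (show x + t ∈ Ioo (a - H) a from
        ⟨by linarith [ht.1], by linarith [ht.2]⟩)]
      rfl
    · rw [indicator_of_notMem ht, indicator_of_notMem]
      intro h
      exact ht ⟨by linarith [h.1], by linarith [h.2]⟩
  simp_rw [hind]
  exact cut_profile_shallow hH0 hHR hRs hN

/-- Shallow profile at the LEFT edge: the kernel `B₄(t,y) = 1_{(−a,−a+H)}(y)/(4tN)` evaluated at
`y = p − t` for a deep left end `p` (`a + p ≥ R`). [folklore] -/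
theorem cut_profile_shallow_left {a p H R N : ℝ} (hH0 : 0 ≤ H) (hHR : H < R) (hRs : R ≤ a + p)
    (hN : 0 < N) :
    ∫⁻ t in Ioi (0 : ℝ), ENNReal.ofReal ((Ioo (-a) (-a + H)).indicator 1 (p - t) / (4 * t * N)) ≤
      ENNReal.ofReal (R / (R - H) * H / (4 * (a + p) * N)) := by
  have hind : ∀ t : ℝ, (Ioo (-a) (-a + H)).indicator (1 : ℝ → ℝ) (p - t) =
      (Ioo (a + p - H) (a + p)).indicator 1 t := by
    intro t
    by_cases ht : t ∈ Ioo (a + p - H) (a + p)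
    · rw [indicator_of_mem ht, indicator_of_mem (show p - t ∈ Ioo (-a) (-a + H) from
        ⟨by linarith [ht.2], by linarith [ht.1]⟩)]
      rfl
    · rw [indicator_of_notMem ht, indicator_of_notMem]
      intro h
      exact ht ⟨by linarith [h.2], by linarith [h.1]⟩
  simp_rw [hind]
  exact cut_profile_shallow hH0 hHR hRs hN

end Summit.RiemannHypothesis.RiemannHypothesis.Theorems.PfPersistence

end
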